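import Literature.NumberTheory.Sieve.GoldbachLinnikRomanovCertDefs
import Literature.NumberTheory.Sieve.GoldbachLinnikRomanovCertData1
import Literature.NumberTheory.Sieve.GoldbachLinnikRomanovCertData2

/-!
# Romanov certificate — head sums 2/7

Kernel evaluation (`decide +kernel`) of the checker of `GoldbachLinnikRomanovCertDefs.lean` on the records
`parseRecs 20000 (digitsOf (fsegs1 ++ fsegs2))` of `GoldbachLinnikRomanovCertData1/2.lean`; soundness: `GoldbachLinnikRomanovCertSound1.lean`,
`GoldbachLinnikRomanovCertTop.lean`. [folklore]
-/

namespace Literature.NumberTheory.Sieve.RomanovCert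

set_option maxHeartbeats 0 in
/-- The head accumulators `(T⁺, T⁻, I, S⁺, S⁻, ok)` on `d ∈ [2, 4)`. [folklore] -/
theorem head_2 : headSums (parseRecs 20000 (digitsOf (fsegs1 ++ fsegs2))) 2 2 = (5545545821483482541, 5547942483933358007, 0, 16038982803488612391321, 16122454320422148112384, true) := by
  decide +kernel

set_option maxHeartbeats 0 in
/-- The head accumulators `(T⁺, T⁻, I, S⁺, S⁻, ok)` on `d ∈ [4, 8)`. [folklore] -/
theorem head_4 : headSums (parseRecs 20000 (digitsOf (fsegs1 ++ fsegs2))) 4 4 = (5229478944034077697, 5226891079695239016, 0, 16316664822503278428615, 16246631864643210654469, true) := by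
  decide +kernel

end Literature.NumberTheory.Sieve.RomanovCert
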